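import Literature.Claims.NS.Iotti2011

/-!
# C28 `Iotti2011` — kernel refutations of p.4 d4 («∇u(x̃,t) = 0» at an absolute maximum point) and
p.4 d2 (the Helmholtz decomposition read pointwise)

Source: M. Iotti, «An estimate for solutions to the Navier–Stokes equations» / `L^∞` bound, arXiv:1107.3403
v2 (version of record for this row; v3 is the author's withdrawal notice). Skeleton of record:
`Literature/Claims/NS/Iotti2011.lean` (p484951, typist-10 g2). Cell ns-claims, D-0090; refuter lane
refuter-2 (first idle refuter, RULINGS v1.29l (2)); referee ref-2 g2; filer salvage-p6 (conv. (b)).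

Authorship: the `rotV` / `∇φ` kit (`not_Step_7Abs`, `not_Step_5Abs`) is typist-10 g2's kill candidate
(claims/Iotti2011/SoloRefuteIotti2011-typist10-KILLCANDIDATE.lean, 9fc7a03f2c19e524), ADOPTED by
refuter-2 with docstrings and fully qualified targets; the divergence-free compactly supported witness
`swirlU` (the datum class (1.2) of the print) and `exists_datumClass_absMax_fderiv_ne_zero` are refuter-2's.

Targets (proof of Theorem 3.1, p. 4; both ON the composition path `claim_of_steps_abs`, feeding
`Display_p5` through `display_of_steps`, in the dependency order d4 → d3 → d2 → d1 used by the print):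

* `Literature.Claims.NS.Iotti2011.Step_7Abs` — p.4 d4 «u is a function differentiable in all variables,
  and be x̃ an absolute maximum point for |u(·,t)|, then we'll have ∇u(x̃,t) = 0» (Fermat's theorem
  applied to the VECTOR field instead of to `|u|²`). Witness 1: the rotating unit field `v(x) = cos(x₂) e₀
  + sin(x₂) e₁`: `|v| ≡ 1` (every point is an absolute maximum point), `∂₂v(0) = e₁ ≠ 0`. Witness 2
  (datum class: smooth, divergence free, compactly supported, hence rapidly decaying): `U(x) =
  σ(2 − |x|²)·(−x₁, x₀, 0)` with `σ` Mathlib's `Real.smoothTransition`; `|U|` attains its maximum at some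
  `x̃` with `U(x̃) ≠ 0`, and there `DU(x̃)[(−x̃₁, x̃₀, 0)] = −σ(2 − |x̃|²)·(x̃₀, x̃₁, 0) ≠ 0`.
* `Literature.Claims.NS.Iotti2011.Step_5Abs` — p.4 d2 «We note that where ∇·(u·∇u) = 0 ⇒ u·∇u =
  P(u·∇u), ∇q₁ = 0, ∇p = ∇q₂» at the grain of its justification (the decomposition `v = Pv + ∇q` read
  POINTWISE). Witness: `v = ∇φ`, `φ(x) = x₀·χ(x)` with `χ` a smooth bump equal to `1` on the unit ball
  and supported in the ball of radius `2`; its Helmholtz pair is `(Pv, q) = (0, φ)`. At `x = 0`: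
  `∇·v(0) = Δφ(0) = 0` (φ is the linear function `x₀` near `0`), but `∇q(0) = e₀ ≠ 0`.

The charitable chain of the skeleton (`claim_of_steps_charitable` through `Step_5min`, the pressure term
`u(x̃,t)·∇q₁(x̃,t) = 0`) is not attacked here: it is the honest non-local residue (unfilled gap at p.4 d2).

WHAT THIS IS NOT: not a claim about NS regularity or blow-up; not a claim about any author beyond the typed
locator.
-/

set_option linter.dupNamespace false

open Set Metric Filter MeasureTheory
open scoped ContDiff Laplacian InnerProductSpace RealInnerProductSpace Topology

namespace Summit.NavierStokesRegularity.NavierStokesRegularity.Theorems.Iotti2011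

open Literature.Analysis.FluidPDE Literature.Claims.NS.Iotti2011

noncomputable section

/-- `ℝ³`. [folklore] -/
abbrev E3 := EuclideanSpace ℝ (Fin 3)

/-- `e₀`. [folklore] -/
def e0 : E3 := EuclideanSpace.single 0 1

/-- `e₁`. [folklore] -/
def e1 : E3 := EuclideanSpace.single 1 1

/-- `e₂`. [folklore] -/
def e2 : E3 := EuclideanSpace.single 2 1

/-- The coordinate functional `x ↦ x₀`. [folklore] -/
def P0 : E3 →L[ℝ] ℝ := EuclideanSpace.proj (0 : Fin 3)

/-- The coordinate functional `x ↦ x₁`. [folklore] -/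
def P1 : E3 →L[ℝ] ℝ := EuclideanSpace.proj (1 : Fin 3)

/-- The coordinate functional `x ↦ x₂`. [folklore] -/
def P2 : E3 →L[ℝ] ℝ := EuclideanSpace.proj (2 : Fin 3)

/-- `P₀ x = x₀`. [folklore] -/
@[simp] theorem P0_apply (x : E3) : P0 x = x 0 := rfl

/-- `P₁ x = x₁`. [folklore] -/
@[simp] theorem P1_apply (x : E3) : P1 x = x 1 := rfl

/-- `P₂ x = x₂`. [folklore] -/
@[simp] theorem P2_apply (x : E3) : P2 x = x 2 := rfl

/-- `e₁ ≠ 0`. [folklore] -/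
theorem e1_ne_zero : e1 ≠ 0 := by
  intro h
  have : e1 1 = 0 := by rw [h]; rfl
  simp [e1] at this

/-! ### Witness 1 against `Step_7Abs` (p.4 d4): the rotating unit field (typist-10 g2's kit) -/

/-- `v(x) = cos(x₂) e₀ + sin(x₂) e₁`. [folklore] -/
def rotV (x : E3) : E3 := Real.cos (x 2) • e0 + Real.sin (x 2) • e1

/-- `|v(x)| = 1` for every `x`. [folklore] -/
theorem norm_rotV (x : E3) : ‖rotV x‖ = 1 := by
  have h : ∑ i, ‖rotV x i‖ ^ 2 = 1 := by
    simp [rotV, e0, e1, Fin.sum_univ_three, Real.cos_sq_add_sin_sq]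
  rw [EuclideanSpace.norm_eq, h, Real.sqrt_one]

/-- Every point is an absolute maximum point of `|v|`. [folklore] -/
theorem isAbsMax_rotV (x : E3) : IsAbsMax rotV x := by
  intro y
  rw [norm_rotV, norm_rotV]

/-- `Dv(x) = (−sin(x₂) P₂) ⊗ e₀ + (cos(x₂) P₂) ⊗ e₁`. [folklore] -/
theorem hasFDerivAt_rotV (x : E3) :
    HasFDerivAt rotV ((-Real.sin (P2 x) • P2).smulRight e0 + (Real.cos (P2 x) • P2).smulRight e1) x := by
  have hc : HasFDerivAt (fun z : E3 => Real.cos (P2 z)) (-Real.sin (P2 x) • P2) x :=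
    (Real.hasDerivAt_cos (P2 x)).comp_hasFDerivAt x P2.hasFDerivAt
  have hs : HasFDerivAt (fun z : E3 => Real.sin (P2 z)) (Real.cos (P2 x) • P2) x :=
    (Real.hasDerivAt_sin (P2 x)).comp_hasFDerivAt x P2.hasFDerivAt
  exact (hc.smul_const e0).add (hs.smul_const e1)

/-- `v` is differentiable. [folklore] -/
theorem differentiable_rotV : Differentiable ℝ rotV := fun x => (hasFDerivAt_rotV x).differentiableAt

/-- `∂₂v(0) = e₁`. [folklore] -/
theorem fderiv_rotV_zero_e2 : fderiv ℝ rotV 0 e2 = e1 := by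
  rw [(hasFDerivAt_rotV 0).fderiv]
  simp [e2]

/-- **C28 kill (p.4 d4): an absolute maximum point of `|v|` need not be a critical point of the vector
field `v`** — `v = cos(x₂)e₀ + sin(x₂)e₁` has `|v| ≡ 1` and `∂₂v(0) = e₁`.
[cite: Iotti2011NSLinfty, proof of Thm 3.1 p.4] -/
theorem not_Step_7Abs : ¬ Literature.Claims.NS.Iotti2011.Step_7Abs := by
  intro h
  have h0 : fderiv ℝ rotV 0 = 0 := h rotV differentiable_rotV 0 (isAbsMax_rotV 0)
  have := fderiv_rotV_zero_e2
  rw [h0] at this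
  exact e1_ne_zero (by simpa using this.symm)

/-! ### Witness 2 against `Step_7Abs`: a divergence-free, compactly supported field (the datum class) -/

/-- The planar rotation `x ↦ (−x₁, x₀, 0)` as a continuous linear map. [folklore] -/
def rotL : E3 →L[ℝ] E3 := P0.smulRight e1 - P1.smulRight e0

/-- `rotL x = x₀ e₁ − x₁ e₀`. [folklore] -/
theorem rotL_apply (x : E3) : rotL x = (x 0) • e1 - (x 1) • e0 := by
  simp [rotL]

/-- `x ⊥ rotL x`. [folklore] -/
theorem inner_rotL_self (x : E3) : ⟪x, rotL x⟫ = 0 := by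
  rw [rotL_apply, inner_sub_right, inner_smul_right, inner_smul_right]
  simp [e0, e1, EuclideanSpace.inner_single_right]
  ring

/-- `rotL (rotL x) = −(x₀ e₀ + x₁ e₁)` vanishes only if `rotL x` does. [folklore] -/
theorem rotL_rotL_ne_zero {x : E3} (hx : rotL x ≠ 0) : rotL (rotL x) ≠ 0 := by
  intro h
  apply hx
  have h0 : rotL (rotL x) 0 = 0 := by rw [h]; rfl
  have h1 : rotL (rotL x) 1 = 0 := by rw [h]; rfl
  simp [rotL_apply, e0, e1] at h0 h1
  rw [rotL_apply, h0, h1, zero_smul, zero_smul, sub_zero]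

/-- The radial cut-off `σ(2 − |x|²)` (`σ` = `Real.smoothTransition`): `1` on the unit ball, `0` outside
the ball of radius `√2`. [folklore] -/
def cut (x : E3) : ℝ := Real.smoothTransition (2 - ‖x‖ ^ 2)

/-- The cut-off is smooth. [folklore] -/
theorem contDiff_cut : ContDiff ℝ ∞ cut :=
  Real.smoothTransition.contDiff.comp (contDiff_const.sub (contDiff_norm_sq ℝ))

/-- Its derivative `Dcut(x) = σ'(2 − |x|²)·(−2⟨x, ·⟩)`. [folklore] -/
def dcut (x : E3) : E3 →L[ℝ] ℝ :=
  deriv Real.smoothTransition (2 - ‖x‖ ^ 2) • (-((2 : ℕ) • innerSL ℝ x))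

/-- `cut` has derivative `dcut`. [folklore] -/
theorem hasFDerivAt_cut (x : E3) : HasFDerivAt cut (dcut x) x := by
  have hσ : HasDerivAt Real.smoothTransition (deriv Real.smoothTransition (2 - ‖x‖ ^ 2))
      (2 - ‖x‖ ^ 2) :=
    ((Real.smoothTransition.contDiff (n := 1)).differentiable (by simp) _).hasDerivAt
  have hg : HasFDerivAt (fun y : E3 => 2 - ‖y‖ ^ 2) (-((2 : ℕ) • innerSL ℝ x)) x :=
    (hasStrictFDerivAt_norm_sq x).hasFDerivAt.const_sub 2
  exact hσ.comp_hasFDerivAt x hg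

/-- The cut-off is radial: `Dcut(x)[rotL x] = 0`. [folklore] -/
theorem dcut_rotL (x : E3) : dcut x (rotL x) = 0 := by
  simp [dcut, inner_rotL_self]

/-- The witness `U(x) = σ(2 − |x|²)·(−x₁, x₀, 0)` — a smooth, compactly supported, divergence-free swirl.
[folklore] -/
def swirlU (x : E3) : E3 := cut x • rotL x

/-- `DU(x) = cut(x)·rotL + Dcut(x) ⊗ rotL x`. [folklore] -/
theorem hasFDerivAt_swirlU (x : E3) :
    HasFDerivAt swirlU (cut x • (rotL : E3 →L[ℝ] E3) + (dcut x).smulRight (rotL x)) x :=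
  (hasFDerivAt_cut x).smul rotL.hasFDerivAt

/-- `DU(x)[v] = cut(x)·rotL v + Dcut(x)[v]·rotL x`. [folklore] -/
theorem fderiv_swirlU_apply (x v : E3) :
    fderiv ℝ swirlU x v = cut x • rotL v + dcut x v • rotL x := by
  rw [(hasFDerivAt_swirlU x).fderiv]
  simp

/-- `U` is smooth. [folklore] -/
theorem contDiff_swirlU : ContDiff ℝ ∞ swirlU := contDiff_cut.smul rotL.contDiff

/-- `U` is differentiable. [folklore] -/
theorem differentiable_swirlU : Differentiable ℝ swirlU := fun x =>
  (hasFDerivAt_swirlU x).differentiableAt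

/-- `U` vanishes outside the closed ball of radius `2` (indeed outside radius `√2`). [folklore] -/
theorem swirlU_eq_zero {x : E3} (hx : 2 ≤ ‖x‖) : swirlU x = 0 := by
  have h2 : 2 - ‖x‖ ^ 2 ≤ 0 := by nlinarith
  simp [swirlU, cut, Real.smoothTransition.zero_of_nonpos h2]

/-- `U` has compact support. [folklore] -/
theorem hasCompactSupport_swirlU : HasCompactSupport swirlU := by
  refine HasCompactSupport.intro (isCompact_closedBall (0 : E3) 2) fun x hx => ?_
  rw [mem_closedBall, dist_zero_right, not_le] at hx
  exact swirlU_eq_zero hx.le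

/-- `U` is divergence free: `div U = cut·tr(rotL) + Dcut[rotL x]`-type terms, both zero
(`tr rotL = 0`, `x ⊥ rotL x`). [folklore] -/
theorem isDivFree_swirlU : VectorCalculus.IsDivFree swirlU := fun x => by
  rw [divergence_eq_sum_inner_fderiv (EuclideanSpace.basisFun (Fin 3) ℝ)]
  simp only [fderiv_swirlU_apply, EuclideanSpace.basisFun_apply, inner_add_right, inner_smul_right,
    Fin.sum_univ_three]
  simp [rotL_apply, dcut, e0, e1, inner_sub_right, inner_smul_right, EuclideanSpace.inner_single_right]
  ring

/-- `U` is a legitimate datum: it decays rapidly (compact support). [folklore] -/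
theorem hasRapidSpatialDecay_swirlU : HasRapidSpatialDecay swirlU := by
  intro n K
  have hcont : Continuous fun x => (1 + ‖x‖) ^ K * ‖iteratedFDeriv ℝ n swirlU x‖ :=
    ((continuous_const.add continuous_norm).pow K).mul
      (contDiff_swirlU.continuous_iteratedFDeriv (m := n) (by exact_mod_cast le_top)).norm
  have hsupp : HasCompactSupport fun x => (1 + ‖x‖) ^ K * ‖iteratedFDeriv ℝ n swirlU x‖ :=
    ((hasCompactSupport_swirlU.iteratedFDeriv (𝕜 := ℝ) n).norm).mul_left
  obtain ⟨C, hC⟩ := hcont.bddAbove_range_of_hasCompactSupport hsupp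
  exact ⟨C, fun x => hC ⟨x, rfl⟩⟩

/-- `U(½e₀) = ½e₁ ≠ 0`: the witness is not the zero field. [folklore] -/
theorem norm_swirlU_half : ‖swirlU ((1 / 2 : ℝ) • e0)‖ = 1 / 2 := by
  have hn : ‖((1 / 2 : ℝ) • e0 : E3)‖ = 1 / 2 := by
    rw [norm_smul, show ‖(e0 : E3)‖ = 1 by simp [e0]]
    norm_num
  have hc : cut ((1 / 2 : ℝ) • e0) = 1 := by
    unfold cut
    rw [hn]
    exact Real.smoothTransition.one_of_one_le (by norm_num)
  have hr : rotL ((1 / 2 : ℝ) • e0) = (1 / 2 : ℝ) • e1 := by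
    rw [rotL_apply]
    simp [e0, e1]
  rw [swirlU, hc, one_smul, hr, norm_smul, show ‖(e1 : E3)‖ = 1 by simp [e1]]
  norm_num

/-- `|U|` attains its maximum, at a point where `U ≠ 0`. [folklore] -/
theorem exists_isAbsMax_swirlU : ∃ x : E3, IsAbsMax swirlU x ∧ swirlU x ≠ 0 := by
  obtain ⟨x, hx⟩ := (contDiff_swirlU.continuous.norm).exists_forall_ge_of_hasCompactSupport
    hasCompactSupport_swirlU.norm
  refine ⟨x, hx, fun h0 => ?_⟩
  have h := hx ((1 / 2 : ℝ) • e0)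
  rw [norm_swirlU_half, h0, norm_zero] at h
  norm_num at h

/-- Wherever `U ≠ 0`, `DU ≠ 0`: `DU(x)[rotL x] = cut(x)·rotL(rotL x) ≠ 0`. [folklore] -/
theorem fderiv_swirlU_ne_zero {x : E3} (hx : swirlU x ≠ 0) : fderiv ℝ swirlU x ≠ 0 := by
  have hc : cut x ≠ 0 := fun h => hx (by rw [swirlU, h, zero_smul])
  have hr : rotL x ≠ 0 := fun h => hx (by rw [swirlU, h, smul_zero])
  intro h
  have h1 := fderiv_swirlU_apply x (rotL x)
  rw [h, dcut_rotL, zero_smul, add_zero] at h1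
  have h2 : cut x • rotL (rotL x) = 0 := by simpa using h1.symm
  exact (smul_ne_zero hc (rotL_rotL_ne_zero hr)) h2

/-- **The datum class does not rescue p.4 d4:** there is a smooth, compactly supported (hence rapidly
decaying), divergence-free field — an admissible datum (1.2) — whose modulus attains its absolute maximum
at a point where the Jacobian is not zero. [folklore] -/
theorem exists_datumClass_absMax_fderiv_ne_zero :
    ∃ v : E3 → E3, ContDiff ℝ ∞ v ∧ HasCompactSupport v ∧ VectorCalculus.IsDivFree v ∧
      HasRapidSpatialDecay v ∧ ∃ x, IsAbsMax v x ∧ fderiv ℝ v x ≠ 0 := by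
  obtain ⟨x, hmax, hne⟩ := exists_isAbsMax_swirlU
  exact ⟨swirlU, contDiff_swirlU, hasCompactSupport_swirlU, isDivFree_swirlU,
    hasRapidSpatialDecay_swirlU, x, hmax, fderiv_swirlU_ne_zero hne⟩

/-- Second, independent proof of `¬ Step_7Abs` from the datum-class witness. [folklore] -/
theorem not_Step_7Abs_of_datumClass : ¬ Literature.Claims.NS.Iotti2011.Step_7Abs := by
  intro h
  obtain ⟨x, hmax, hne⟩ := exists_isAbsMax_swirlU
  exact fderiv_swirlU_ne_zero hne (h swirlU differentiable_swirlU x hmax)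

/-! ### Witness against `Step_5Abs` (p.4 d2): a compactly supported gradient, harmonic near the origin
(typist-10 g2's kit) -/

/-- A smooth bump at the origin: `χ = 1` on the closed unit ball, `supp χ ⊆ B(0,2)`. [folklore] -/
def χ : ContDiffBump (0 : E3) := ⟨1, 2, one_pos, one_lt_two⟩

/-- `φ(x) = x₀ χ(x)`. [folklore] -/
def φ (x : E3) : ℝ := x 0 * χ x

/-- The witness field `v = ∇φ`. [folklore] -/
def vG (x : E3) : E3 := gradient φ x

/-- Its Leray part `Pv = 0`. [folklore] -/
def wG : E3 → E3 := fun _ => 0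

/-- `φ` is smooth and compactly supported (stated jointly). [folklore] -/
theorem φ_smooth_compact : ContDiff ℝ ∞ φ ∧ HasCompactSupport φ :=
  ⟨P0.contDiff.mul χ.contDiff, χ.hasCompactSupport.mul_left⟩

/-- `∇φ` is continuous. [folklore] -/
theorem continuous_gradient_φ : Continuous fun x => gradient φ x := by
  have hF : Continuous fun y => fderiv ℝ φ y := φ_smooth_compact.1.continuous_fderiv (by norm_cast)
  change Continuous fun y => (InnerProductSpace.toDual ℝ E3).symm (fderiv ℝ φ y)
  exact (InnerProductSpace.toDual ℝ E3).symm.continuous.comp hF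

/-- `∇φ` is smooth. [folklore] -/
theorem contDiff_vG : ContDiff ℝ ∞ vG := by
  have hF : ContDiff ℝ ∞ fun y => fderiv ℝ φ y := φ_smooth_compact.1.fderiv_right (by norm_cast)
  change ContDiff ℝ ∞ fun y => (InnerProductSpace.toDual ℝ E3).symm (fderiv ℝ φ y)
  exact (InnerProductSpace.toDual ℝ E3).symm.contDiff.comp hF

/-- `∇φ` has compact support. [folklore] -/
theorem hasCompactSupport_gradient_φ : HasCompactSupport fun x => gradient φ x := by
  have h1 : HasCompactSupport (fderiv ℝ φ) := φ_smooth_compact.2.fderiv (𝕜 := ℝ)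
  change HasCompactSupport fun y => (InnerProductSpace.toDual ℝ E3).symm (fderiv ℝ φ y)
  exact h1.comp_left (map_zero _)

/-- `(0, φ)` is the Helmholtz pair of `∇φ`. [folklore] -/
theorem isHelmholtzPair_vG : IsHelmholtzPair vG wG φ where
  smooth_left := contDiff_const
  smooth_potential := φ_smooth_compact.1
  decomp x := by simp [vG, wG]
  divFree x := by
    have h0 : fderiv ℝ wG x = 0 := (hasFDerivAt_const (0 : E3) x).fderiv
    rw [VectorCalculus.divergence, h0]
    simp
  sqIntegrable_left := by
    simp [wG]
  sqIntegrable_grad := by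
    refine Continuous.integrable_of_hasCompactSupport (continuous_gradient_φ.norm.pow 2) ?_
    exact hasCompactSupport_gradient_φ.comp_left (g := fun y : E3 => ‖y‖ ^ 2) (by simp)

/-- Near the origin `φ` is the coordinate function `x₀`. [folklore] -/
theorem φ_eventuallyEq {y : E3} (hy : y ∈ ball (0 : E3) 1) : φ =ᶠ[𝓝 y] fun z => z 0 := by
  filter_upwards [isOpen_ball.mem_nhds hy] with z hz
  have h1 : χ z = 1 := χ.one_of_mem_closedBall (ball_subset_closedBall hz)
  simp [φ, h1]

/-- `(toDual e₀) = P₀`, i.e. `∇(x ↦ x₀) = e₀`. [folklore] -/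
theorem gradient_coord (y : E3) : gradient (fun z : E3 => z 0) y = e0 := by
  have hd : (InnerProductSpace.toDual ℝ E3) e0 = P0 := by
    ext v
    simp [e0, EuclideanSpace.inner_single_left]
  have hF : HasFDerivAt (fun z : E3 => z 0) ((InnerProductSpace.toDual ℝ E3) e0) y := by
    rw [hd]
    exact P0.hasFDerivAt
  exact (hasGradientAt_iff_hasFDerivAt.mpr hF).gradient

/-- Near the origin `∇φ = e₀`. [folklore] -/
theorem gradient_φ_eq {y : E3} (hy : y ∈ ball (0 : E3) 1) : gradient φ y = e0 := by
  rw [← gradient_coord y]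
  unfold gradient
  rw [(φ_eventuallyEq hy).fderiv_eq]

/-- `∇·(∇φ)(0) = 0`: the witness is divergence free at the origin (indeed on the unit ball). [folklore] -/
theorem divergence_vG_zero : VectorCalculus.divergence vG 0 = 0 := by
  have hev : vG =ᶠ[𝓝 (0 : E3)] fun _ => e0 := by
    filter_upwards [isOpen_ball.mem_nhds (mem_ball_self one_pos)] with z hz
    exact gradient_φ_eq hz
  have hfd : fderiv ℝ vG 0 = 0 := by
    rw [hev.fderiv_eq, fderiv_const_apply]
  simp [VectorCalculus.divergence, hfd]

/-- `∇φ(0) = e₀ ≠ 0`. [folklore] -/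
theorem gradient_φ_zero_ne : gradient φ 0 ≠ 0 := by
  rw [gradient_φ_eq (mem_ball_self one_pos)]
  intro h
  have : e0 0 = 0 := by rw [h]; rfl
  simp [e0] at this

/-- **C28 kill (p.4 d2): the Helmholtz–Leray decomposition is not pointwise — a field can be divergence
free at a point where its gradient part does not vanish.** [cite: Iotti2011NSLinfty, proof of Thm 3.1 p.4] -/
theorem not_Step_5Abs : ¬ Literature.Claims.NS.Iotti2011.Step_5Abs := by
  intro h
  have h0 := (h vG wG φ contDiff_vG isHelmholtzPair_vG 0 divergence_vG_zero).1
  exact gradient_φ_zero_ne h0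

end

end Summit.NavierStokesRegularity.NavierStokesRegularity.Theorems.Iotti2011
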